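import Summits.QuantumFields.BalabanUV.Beta.GAN24.FineReadoutCauchyFrame
import Summits.QuantumFields.BalabanUV.Beta.GAN24.FineReadoutDecay

/-!
# `BalabanUV.Beta.GAN24.FineReadoutCauchyReal` — «(N1-Cauchy)» NEEDS THE DIFFERENCE SYMBOL ONLY ON THE REAL ZONE: (N1) + a real-zone sup rate ⟹ the
# cell-mean one-step convergence with block decay, by the K-slot's geometric-mean device (`CombesThomas.cauchyDecayK_of_unitDecayK_supRateK`)

**G-an2-4 FORMALISATION SWARM, b2b-balaban-gan24-formalise-leaf-13 (gen 18) — a remark on PART S of the located leaf «(N1-Cauchy)» of the S3 RATE table**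
(owner's typed spec `HOME/b2b-balaban-gan24-p1/N1-CAUCHY-SPEC.md` v1; holder leaf-17, division `HOME/b2b-balaban-gan24-formalise-leaf-17/g11/N1-CAUCHY-DIVISION.md` v1;
PART F = `GAN24/FineReadoutCauchyFrame`).  NOT IN PRINT; OUR PROOF ATTEMPT.  [folklore] bookkeeping over PART F, (N1) and two tree inequalities; no new analysis.

HONEST FRAMING (verbatim): «discharging `BetaPertH` makes Bałaban's UV stability UNCONDITIONAL — a real constructive-QFT result; it is NOT the continuum
limit and NOT the Clay problem.»  HONEST DEPENDENCY (verbatim): «continuum YM on T⁴ ⇐ BetaPertH ∧ nine spine estimates (0/9 proved); BetaPertH ⇐ (D1) ∧ (D4) ∧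
CAP+tail; G-an2-4 gates asym, D1 and NE2/3/4.»  No cited fact, no `def … : Prop`, no wall binder; the real-zone rate `hR` is a HYPOTHESIS (parts N∕A∕C∕K of the
division are to conclude it); discharges NOTHING of «(N1-Cauchy)» by itself, of «E3SupRate»∕«E3Shape», of (hS, hSall); NOT BetaPertH, NOT continuum, NOT Clay.

## Why (the K-slot pattern)
Road P1 closed the K-slot from a `j`-UNIFORM decaying bound (`UnitDecayK`, from strip regularity) and a `j`-GEOMETRIC sup rate with NO decay
(`SupRateK`, from the REAL-zone symbol rate `RealRateK` via `CombesThomasFibre.abs_re_latticeKernel_le_of_norm_le`), glued by `min(a,b) ≤ √(ab)`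
(`King1986.abs_le_sqrt_mul_exp_half`; `CombesThomas.cauchyDecayK_of_unitDecayK_supRateK`: rate `√θ`, decay `δ/2`).  The same applies VERBATIM to the cell-mean
one-step comparison of the normalised minimiser column, because PART F makes it ONE lattice kernel (`cellMean_sub_eq_re_latticeKernel`):
* the UNIFORM decaying bound is (N1) at the two levels (`FineReadoutDecay.exists_wH_decay`; the cell points `Lc•z + r` keep the block label, `quo_cell`);
* the sup rate needs the difference symbol `diffSym` ONLY AT REAL momenta — no strip regularity of `diffSym`, no continuity onto a caveat set.
The price — `θ ↦ √θ`, `κ₁ ↦ κ₀/2` — is free in the RATE END (`θ`, `κ₁` are its parameters).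

## What is proved (generic `d`; `N′ = N·Lc`)
* §1 `card_box_eq`, `abs_cellMean_sub_le_of_decay`: (N1)-shape bounds at the two levels ⟹ `|Δ| ≤ 2C·e^{−κ₀‖quo_N z‖∞}` (NO rate).
* §2 `abs_cellMean_sub_le_of_realBound` (continuity of `diffSym` along the real zone inlined — the named lemma is the holder's `FineReadoutCauchyOfPieces.continuous_diffSym_ofRealVec`): `(∀ p ∈ BZ, ‖diffSym … (ofRealVec p)‖ ≤ ε) ⟹ |Δ| ≤ ε` (NO decay).
* §3 (with `CombesThomas.sqrt_pow_eq` BY NAME) **`exists_wH_cellMean_cauchy_of_realRate`**: (N1)-shape at all levels with one `(κ₀, C)` + `(hR : ∀ n κ l z, ∀ p ∈ BZ, ‖diffSym (Lc^(n+1)) (Lc^(n+2)) Lc κ l z (ofRealVec p)‖ ≤ c·θ^n)`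
  ⟹ the owner's §1 shape VERBATIM: `∃ c′ θ′ κ′, 0 ≤ c′ ∧ 0 ≤ θ′ ∧ θ′ < 1 ∧ 0 < κ′ ∧ ∀ n κ l z, |Δ_n(κ,l,z)| ≤ c′·θ′^n·e^{−κ′·|quo (Lc^(n+1)) z|₁}` with
  `(c′, θ′, κ′) = (√(2C·c), √θ, κ₀/(2(d+1)))`.
  `exists_wH_cellMean_cauchy_of_puncturedRate`: the same with `hR` asked only on `BZ ∖ {0}` (continuity of `diffSym` along the real zone,
  `FibreContinuity.norm_le_on_BZ_of_punctured'` — the K-slot's `realRateK_of_punctured` pattern).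
* §4 `d = 3`: **`exists_wH_cellMean_cauchy_three_of_realRate`** ∕ **`…_three_of_puncturedRate`** — the same with (N1) discharged BY NAME
  (`FineReadoutDecay.exists_wH_decay`): «(N1-Cauchy)» at d = 3 ⇐ the (punctured) REAL-ZONE rate of the difference symbols, nothing else.
Unit `b2b-balaban-gan24-formalise-leaf-13` (gen 18; records), 2026-08-20.
-/

noncomputable section

open Complex MeasureTheory Finset
open scoped BigOperators Real
open Literature.Probability.LatticeModels (TorusSite Torus.proj)
open Literature.MathematicalPhysics.QuantumFieldTheory
open Literature.MathematicalPhysics.QuantumFieldTheory.LatticeForm (quo)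
open Literature.MathematicalPhysics.QuantumFieldTheory.Balaban1983to89
open Literature.MathematicalPhysics.QuantumFieldTheory.Balaban1983to89.Beta
open B12Sec2to5 (l1 l1_nonneg)
open B4Strip (ofRealVec)
open B4ContourShift (latticeKernel BZ supNorm abs_le_supNorm supNorm_nonneg)
open AffineAveraging (box toSite)
open KernelSpecInstance (wH)
open Beta.FibreInverseDecay (isCompact_BZ)
open Summit.QuantumFields.BalabanUV.Beta.GAN24.CombesThomasFibre (fibInv abs_re_latticeKernel_le_of_norm_le)
open Summit.QuantumFields.BalabanUV.Beta.GAN24.FibreContinuity (continuous_fibInv_ofRealVec norm_le_on_BZ_of_punctured')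
open Summit.QuantumFields.BalabanUV.Beta.GAN24.FineReadoutCauchyFrame (quo_cell diffSym cellMean_sub_eq_re_latticeKernel)
open Summit.QuantumFields.BalabanUV.Beta.GAN24.FineReadoutDecay (exists_wH_decay)

namespace Summit.QuantumFields.BalabanUV.Beta.GAN24.FineReadoutCauchyReal

variable {d : ℕ}

/-! ## §1 The uniform decaying bound from (N1) at the two levels (no rate) -/

/-- [folklore] `#box (d+1) Lc = Lc^{d+1}`. -/
theorem card_box_eq (Lc : ℕ) : ((box (d + 1) Lc).card : ℝ) = (Lc : ℝ) ^ (d + 1) := by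
  have h : (box (d + 1) Lc).card = Lc ^ (d + 1) := by
    show (Fintype.piFinset fun _ : Fin (d + 1) => Finset.range Lc).card = Lc ^ (d + 1)
    rw [Fintype.card_piFinset, Finset.prod_const, Finset.card_range, Finset.card_univ, Fintype.card_fin]
  exact_mod_cast h

/-- [folklore] **UNIFORM DECAY, NO RATE**: if the normalised columns of the two blockings `N` and `N′ = N·Lc` obey (N1)-shape bounds with the same
`(C, κ₀)` — `|N^{d+2}·wH_N κ l z| ≤ C·e^{−κ₀‖quo_N z‖∞}`, `|N′^{d+2}·wH_{N′} κ l z′| ≤ C·e^{−κ₀‖quo_{N′} z′‖∞}` — then the cell-mean difference obeys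
`|Δ| ≤ 2C·e^{−κ₀‖quo_N z‖∞}` (every cell point `Lc•z + r` has block label `quo_N z`, PART F `quo_cell`). -/
theorem abs_cellMean_sub_le_of_decay (N N' Lc : ℕ) [NeZero N] [NeZero N'] [NeZero Lc] (hN : N' = N * Lc) {C κ₀ : ℝ}
    (κ l : Fin (d + 1)) (z : Fin (d + 1) → ℤ)
    (hlo : |((N : ℝ) ^ (d + 2)) * wH (N := N) κ l z| ≤ C * Real.exp (-(κ₀ * supNorm (quo N z))))
    (hhi : ∀ z' : Fin (d + 1) → ℤ, |((N' : ℝ) ^ (d + 2)) * wH (N := N') κ l z'| ≤ C * Real.exp (-(κ₀ * supNorm (quo N' z')))) :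
    |((Lc : ℝ) ^ (d + 1))⁻¹ * ∑ r ∈ box (d + 1) Lc, ((N' : ℝ) ^ (d + 2)) * wH (N := N') κ l ((Lc : ℤ) • z + toSite r) -
        ((N : ℝ) ^ (d + 2)) * wH (N := N) κ l z| ≤ 2 * C * Real.exp (-(κ₀ * supNorm (quo N z))) := by
  have hLc : (0 : ℝ) < (Lc : ℝ) ^ (d + 1) := by
    have : (0 : ℝ) < Lc := by exact_mod_cast Nat.pos_of_ne_zero (NeZero.ne Lc)
    positivity
  set E : ℝ := C * Real.exp (-(κ₀ * supNorm (quo N z))) with hE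
  -- every cell term is bounded by `E`
  have hcell : ∀ r ∈ box (d + 1) Lc, |((N' : ℝ) ^ (d + 2)) * wH (N := N') κ l ((Lc : ℤ) • z + toSite r)| ≤ E := by
    intro r hr
    have h := hhi ((Lc : ℤ) • z + toSite r)
    rwa [quo_cell hN z hr] at h
  have hsum : |∑ r ∈ box (d + 1) Lc, ((N' : ℝ) ^ (d + 2)) * wH (N := N') κ l ((Lc : ℤ) • z + toSite r)| ≤ (Lc : ℝ) ^ (d + 1) * E := by
    refine (Finset.abs_sum_le_sum_abs _ _).trans ?_
    calc ∑ r ∈ box (d + 1) Lc, |((N' : ℝ) ^ (d + 2)) * wH (N := N') κ l ((Lc : ℤ) • z + toSite r)|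
        ≤ ∑ _r ∈ box (d + 1) Lc, E := Finset.sum_le_sum hcell
      _ = (Lc : ℝ) ^ (d + 1) * E := by rw [Finset.sum_const, nsmul_eq_mul, card_box_eq]
  have hmean : |((Lc : ℝ) ^ (d + 1))⁻¹ * ∑ r ∈ box (d + 1) Lc, ((N' : ℝ) ^ (d + 2)) * wH (N := N') κ l ((Lc : ℤ) • z + toSite r)| ≤ E := by
    rw [abs_mul, abs_inv, abs_of_pos hLc]
    calc ((Lc : ℝ) ^ (d + 1))⁻¹ * |∑ r ∈ box (d + 1) Lc, ((N' : ℝ) ^ (d + 2)) * wH (N := N') κ l ((Lc : ℤ) • z + toSite r)|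
        ≤ ((Lc : ℝ) ^ (d + 1))⁻¹ * ((Lc : ℝ) ^ (d + 1) * E) := mul_le_mul_of_nonneg_left hsum (by positivity)
      _ = E := by rw [← mul_assoc, inv_mul_cancel₀ hLc.ne', one_mul]
  calc _ ≤ |((Lc : ℝ) ^ (d + 1))⁻¹ * ∑ r ∈ box (d + 1) Lc, ((N' : ℝ) ^ (d + 2)) * wH (N := N') κ l ((Lc : ℤ) • z + toSite r)| +
        |((N : ℝ) ^ (d + 2)) * wH (N := N) κ l z| := abs_sub _ _
    _ ≤ E + E := add_le_add hmean hlo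
    _ = 2 * C * Real.exp (-(κ₀ * supNorm (quo N z))) := by rw [hE]; ring

/-! ## §2 The sup bound from the REAL zone (no decay) -/

/-- [folklore] **REAL-ZONE BOUND ⟹ SUP BOUND, NO DECAY** (the two lines of `CombesThomasFibreStep.supRateK_of_kFib`): a bound `ε` on the difference
symbol along the real Brillouin zone bounds the cell-mean difference by `ε` at EVERY fine site. -/
theorem abs_cellMean_sub_le_of_realBound (N N' Lc : ℕ) [NeZero N] [NeZero N'] [NeZero Lc] (hN : N' = N * Lc) {ε : ℝ}
    (κ l : Fin (d + 1)) (z : Fin (d + 1) → ℤ) (hR : ∀ p ∈ BZ (d + 1), ‖diffSym N N' Lc κ l z (ofRealVec p)‖ ≤ ε) :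
    |((Lc : ℝ) ^ (d + 1))⁻¹ * ∑ r ∈ box (d + 1) Lc, ((N' : ℝ) ^ (d + 2)) * wH (N := N') κ l ((Lc : ℤ) • z + toSite r) -
        ((N : ℝ) ^ (d + 2)) * wH (N := N) κ l z| ≤ ε := by
  rw [cellMean_sub_eq_re_latticeKernel N N' Lc hN κ l z]
  -- continuity of the difference symbol along the real zone (inlined; the named lemma is the holder's
  -- `FineReadoutCauchyOfPieces.continuous_diffSym_ofRealVec`, at the gate — not restated here)
  have hcont : Continuous (fun p : Fin (d + 1) → ℝ => diffSym N N' Lc κ l z (ofRealVec p)) := by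
    unfold diffSym
    exact (continuous_const.mul (continuous_finsetSum _ fun r _ => continuous_fibInv_ofRealVec _ _)).sub
      (continuous_const.mul (continuous_fibInv_ofRealVec _ _))
  refine abs_re_latticeKernel_le_of_norm_le _ _ ?_ hR
  exact (hcont.norm).continuousOn.integrableOn_compact (isCompact_BZ _)

/-! ## §3 Geometric mean: «(N1-Cauchy)» from (N1) and a real-zone rate -/

/-- [folklore] **«(N1-Cauchy)» FROM (N1) AND A REAL-ZONE RATE** (generic `d`; the K-slot pattern).  Hypotheses: an (N1)-shape bound of the
normalised minimiser column at EVERY level `N = Lc^(j+1)` with one `(κ₀, C)` (leaf-18's (N1); at `d = 3` this is `FineReadoutDecay.exists_wH_decay`),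
and a `n`-GEOMETRIC bound `c·θ^n` of the difference symbols of PART F ALONG THE REAL ZONE ONLY.  Conclusion: the owner's §1 shape of «(N1-Cauchy)»
VERBATIM, with `(c′, θ′, κ′) = (√(2C·c), √θ, κ₀/(2(d+1)))` — `min(c·θ^n, 2C·e^{−κ₀‖·‖∞}) ≤ √(2Cc)·(√θ)^n·e^{−(κ₀/2)‖·‖∞}` (`King1986.abs_le_sqrt_mul_exp_half`). -/
theorem exists_wH_cellMean_cauchy_of_realRate (Lc : ℕ) [NeZero Lc] {κ₀ C c θ : ℝ} (hκ₀ : 0 < κ₀) (hc : 0 ≤ c)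
    (hθ0 : 0 ≤ θ) (hθ1 : θ < 1)
    (hN1 : ∀ (j : ℕ) (κ l : Fin (d + 1)) (z : Fin (d + 1) → ℤ),
      |wH (N := Lc ^ (j + 1)) κ l z| ≤ C * (((Lc ^ (j + 1) : ℕ) : ℝ) ^ (d + 2))⁻¹ * Real.exp (-(κ₀ * supNorm (quo (Lc ^ (j + 1)) z))))
    (hR : ∀ (n : ℕ) (κ l : Fin (d + 1)) (z : Fin (d + 1) → ℤ), ∀ p ∈ BZ (d + 1),
      ‖diffSym (Lc ^ (n + 1)) (Lc ^ (n + 2)) Lc κ l z (ofRealVec p)‖ ≤ c * θ ^ n) :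
    ∃ c' θ' κ' : ℝ, 0 ≤ c' ∧ 0 ≤ θ' ∧ θ' < 1 ∧ 0 < κ' ∧ ∀ (n : ℕ) (κ l : Fin (d + 1)) (z : Fin (d + 1) → ℤ),
      |((Lc : ℝ) ^ (d + 1))⁻¹ * ∑ r ∈ box (d + 1) Lc,
            ((Lc : ℝ) ^ (n + 2)) ^ (d + 2) * wH (N := Lc ^ (n + 2)) κ l ((Lc : ℤ) • z + toSite r) -
          ((Lc : ℝ) ^ (n + 1)) ^ (d + 2) * wH (N := Lc ^ (n + 1)) κ l z| ≤
        c' * θ' ^ n * Real.exp (-κ' * l1 (quo (Lc ^ (n + 1)) z)) := by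
  refine ⟨Real.sqrt (2 * C * c), Real.sqrt θ, κ₀ / (2 * ((d : ℝ) + 1)), Real.sqrt_nonneg _, Real.sqrt_nonneg _,
    (Real.sqrt_lt' one_pos).2 (by rwa [one_pow]), by positivity, fun n κ l z => ?_⟩
  haveI : NeZero (Lc ^ (n + 1)) := ⟨pow_ne_zero _ (NeZero.ne Lc)⟩
  haveI : NeZero (Lc ^ (n + 2)) := ⟨pow_ne_zero _ (NeZero.ne Lc)⟩
  have hpow : Lc ^ (n + 2) = Lc ^ (n + 1) * Lc := pow_succ Lc (n + 1)
  -- the (N1)-shape bounds in the form `|N^{d+2}·wH| ≤ C·e^{…}`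
  have hunit : ∀ (j : ℕ) (z' : Fin (d + 1) → ℤ),
      |(((Lc ^ (j + 1) : ℕ) : ℝ) ^ (d + 2)) * wH (N := Lc ^ (j + 1)) κ l z'| ≤ C * Real.exp (-(κ₀ * supNorm (quo (Lc ^ (j + 1)) z'))) := by
    intro j z'
    have hNpos : (0 : ℝ) < (((Lc ^ (j + 1) : ℕ) : ℝ) ^ (d + 2)) := by
      have : (0 : ℝ) < ((Lc ^ (j + 1) : ℕ) : ℝ) := by exact_mod_cast Nat.pos_of_ne_zero (pow_ne_zero _ (NeZero.ne Lc))
      positivity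
    have h := hN1 j κ l z'
    rw [abs_mul, abs_of_pos hNpos]
    calc (((Lc ^ (j + 1) : ℕ) : ℝ) ^ (d + 2)) * |wH (N := Lc ^ (j + 1)) κ l z'|
        ≤ (((Lc ^ (j + 1) : ℕ) : ℝ) ^ (d + 2)) * (C * ((((Lc ^ (j + 1) : ℕ) : ℝ) ^ (d + 2))⁻¹) *
            Real.exp (-(κ₀ * supNorm (quo (Lc ^ (j + 1)) z')))) := mul_le_mul_of_nonneg_left h hNpos.le
      _ = C * Real.exp (-(κ₀ * supNorm (quo (Lc ^ (j + 1)) z'))) := by field_simp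
  -- (i) uniform decay, no rate
  have hdec := abs_cellMean_sub_le_of_decay (Lc ^ (n + 1)) (Lc ^ (n + 2)) Lc hpow κ l z (hunit n z) (fun z' => hunit (n + 1) z')
  -- (ii) sup rate, no decay
  have hsup := abs_cellMean_sub_le_of_realBound (Lc ^ (n + 1)) (Lc ^ (n + 2)) Lc hpow κ l z (hR n κ l z)
  -- cast bookkeeping: `((Lc^(n+2) : ℕ) : ℝ)^(d+2) = ((Lc:ℝ)^(n+2))^(d+2)`
  have e1 : (((Lc ^ (n + 2) : ℕ) : ℝ) ^ (d + 2)) = ((Lc : ℝ) ^ (n + 2)) ^ (d + 2) := by push_cast; ring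
  have e2 : (((Lc ^ (n + 1) : ℕ) : ℝ) ^ (d + 2)) = ((Lc : ℝ) ^ (n + 1)) ^ (d + 2) := by push_cast; ring
  rw [e1, e2] at hdec hsup
  -- (iii) geometric mean
  have hgm := King1986.abs_le_sqrt_mul_exp_half (mul_nonneg hc (pow_nonneg hθ0 n)) hsup hdec
  -- `√(cθ^n · 2C) = √(2Cc)·(√θ)^n`
  have e3 : Real.sqrt (c * θ ^ n * (2 * C)) = Real.sqrt (2 * C * c) * Real.sqrt θ ^ n := by
    rw [show c * θ ^ n * (2 * C) = (2 * C * c) * θ ^ n by ring, Real.sqrt_mul' _ (pow_nonneg hθ0 n), CombesThomas.sqrt_pow_eq hθ0]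
  rw [e3] at hgm
  refine hgm.trans (mul_le_mul_of_nonneg_left ?_ (by positivity))
  -- sup-norm decay at rate `κ₀/2` ⇒ `ℓ¹` decay at rate `κ₀/(2(d+1))`
  rw [Real.exp_le_exp]
  -- `|q|₁ ≤ (d+1)·‖q‖∞` (inlined, as in PART F: the tree's `T4GaugeActionRatePair.l1_le_mul_supNorm` lives in an unrelated import cone)
  have hl : l1 (quo (Lc ^ (n + 1)) z) ≤ ((d : ℝ) + 1) * supNorm (quo (Lc ^ (n + 1)) z) := by
    unfold l1
    calc ∑ μ, |((quo (Lc ^ (n + 1)) z μ : ℤ) : ℝ)| ≤ ∑ _μ : Fin (d + 1), supNorm (quo (Lc ^ (n + 1)) z) := by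
          refine Finset.sum_le_sum fun μ _ => ?_
          have h := abs_le_supNorm (quo (Lc ^ (n + 1)) z) μ
          rwa [Int.cast_abs] at h
      _ = ((d : ℝ) + 1) * supNorm (quo (Lc ^ (n + 1)) z) := by
          rw [Finset.sum_const, Finset.card_univ, Fintype.card_fin, nsmul_eq_mul]; push_cast; ring
  have hd : (0 : ℝ) < (d : ℝ) + 1 := by positivity
  have : κ₀ / (2 * ((d : ℝ) + 1)) * l1 (quo (Lc ^ (n + 1)) z) ≤ κ₀ / 2 * supNorm (quo (Lc ^ (n + 1)) z) := by
    calc κ₀ / (2 * ((d : ℝ) + 1)) * l1 (quo (Lc ^ (n + 1)) z)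
        ≤ κ₀ / (2 * ((d : ℝ) + 1)) * (((d : ℝ) + 1) * supNorm (quo (Lc ^ (n + 1)) z)) :=
          mul_le_mul_of_nonneg_left hl (by positivity)
      _ = κ₀ / 2 * supNorm (quo (Lc ^ (n + 1)) z) := by field_simp
  linarith

/-- [folklore] **PUNCTURED-ZONE FORM** (what the part holders deliver, as road P1's `FibreContinuity.realRateK_of_punctured` did for the K-slot): the
real-zone rate is needed only OFF `q = 0` — the difference symbol is continuous along the real zone (`continuous_diffSym_ofRealVec`), so a bound on
`BZ ∖ {0}` extends to `BZ` (`FibreContinuity.norm_le_on_BZ_of_punctured'`). -/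
theorem exists_wH_cellMean_cauchy_of_puncturedRate (Lc : ℕ) [NeZero Lc] {κ₀ C c θ : ℝ} (hκ₀ : 0 < κ₀) (hc : 0 ≤ c)
    (hθ0 : 0 ≤ θ) (hθ1 : θ < 1)
    (hN1 : ∀ (j : ℕ) (κ l : Fin (d + 1)) (z : Fin (d + 1) → ℤ),
      |wH (N := Lc ^ (j + 1)) κ l z| ≤ C * (((Lc ^ (j + 1) : ℕ) : ℝ) ^ (d + 2))⁻¹ * Real.exp (-(κ₀ * supNorm (quo (Lc ^ (j + 1)) z))))
    (hR : ∀ (n : ℕ) (κ l : Fin (d + 1)) (z : Fin (d + 1) → ℤ), ∀ p ∈ BZ (d + 1), p ≠ 0 →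
      ‖diffSym (Lc ^ (n + 1)) (Lc ^ (n + 2)) Lc κ l z (ofRealVec p)‖ ≤ c * θ ^ n) :
    ∃ c' θ' κ' : ℝ, 0 ≤ c' ∧ 0 ≤ θ' ∧ θ' < 1 ∧ 0 < κ' ∧ ∀ (n : ℕ) (κ l : Fin (d + 1)) (z : Fin (d + 1) → ℤ),
      |((Lc : ℝ) ^ (d + 1))⁻¹ * ∑ r ∈ box (d + 1) Lc,
            ((Lc : ℝ) ^ (n + 2)) ^ (d + 2) * wH (N := Lc ^ (n + 2)) κ l ((Lc : ℤ) • z + toSite r) -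
          ((Lc : ℝ) ^ (n + 1)) ^ (d + 2) * wH (N := Lc ^ (n + 1)) κ l z| ≤
        c' * θ' ^ n * Real.exp (-κ' * l1 (quo (Lc ^ (n + 1)) z)) := by
  refine exists_wH_cellMean_cauchy_of_realRate Lc hκ₀ hc hθ0 hθ1 hN1 fun n κ l z => ?_
  haveI : NeZero (Lc ^ (n + 1)) := ⟨pow_ne_zero _ (NeZero.ne Lc)⟩
  haveI : NeZero (Lc ^ (n + 2)) := ⟨pow_ne_zero _ (NeZero.ne Lc)⟩
  have hcont : Continuous (fun p : Fin (d + 1) → ℝ => diffSym (Lc ^ (n + 1)) (Lc ^ (n + 2)) Lc κ l z (ofRealVec p)) := by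
    unfold diffSym
    exact (continuous_const.mul (continuous_finsetSum _ fun r _ => continuous_fibInv_ofRealVec _ _)).sub
      (continuous_const.mul (continuous_fibInv_ofRealVec _ _))
  exact norm_le_on_BZ_of_punctured' hcont (hR n κ l z)

/-! ## §4 `d = 3`: (N1) BY NAME -/

/-- [folklore] **«(N1-Cauchy)» AT `d = 3` FROM A REAL-ZONE RATE ALONE**: with leaf-16's (N1) `FineReadoutDecay.exists_wH_decay` (UNCONDITIONAL, every `Lc ≥ 1`),
a `n`-geometric bound of PART F's difference symbols along the REAL Brillouin zone is ALL that «(N1-Cauchy)» (owner's §1, d = 3) still needs. -/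
theorem exists_wH_cellMean_cauchy_three_of_realRate (Lc : ℕ) [NeZero Lc] {c θ : ℝ} (hc : 0 ≤ c) (hθ0 : 0 ≤ θ) (hθ1 : θ < 1)
    (hR : ∀ (n : ℕ) (κ l : Fin 4) (z : Fin 4 → ℤ), ∀ p ∈ BZ 4,
      ‖diffSym (Lc ^ (n + 1)) (Lc ^ (n + 2)) Lc κ l z (ofRealVec p)‖ ≤ c * θ ^ n) :
    ∃ c' θ' κ' : ℝ, 0 ≤ c' ∧ 0 ≤ θ' ∧ θ' < 1 ∧ 0 < κ' ∧ ∀ (n : ℕ) (κ l : Fin 4) (z : Fin 4 → ℤ),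
      |((Lc : ℝ) ^ (3 + 1))⁻¹ * ∑ r ∈ box (3 + 1) Lc,
            ((Lc : ℝ) ^ (n + 2)) ^ (3 + 2) * wH (N := Lc ^ (n + 2)) κ l ((Lc : ℤ) • z + toSite r) -
          ((Lc : ℝ) ^ (n + 1)) ^ (3 + 2) * wH (N := Lc ^ (n + 1)) κ l z| ≤
        c' * θ' ^ n * Real.exp (-κ' * l1 (quo (Lc ^ (n + 1)) z)) := by
  obtain ⟨κ₀, C, hκ₀, _, hN1⟩ := exists_wH_decay (Lc := Lc)
  exact exists_wH_cellMean_cauchy_of_realRate (d := 3) Lc hκ₀ hc hθ0 hθ1 hN1 hR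

/-- [folklore] **«(N1-Cauchy)» AT `d = 3` FROM A PUNCTURED REAL-ZONE RATE** — the form the part holders deliver (`q ∈ BZ ∖ {0}`, where road P1's
capacitance closed forms live: `CapacitanceRateScaled.scaled_cap_inv_*_rate`, `FibreRateMM.mm_rate`, …). -/
theorem exists_wH_cellMean_cauchy_three_of_puncturedRate (Lc : ℕ) [NeZero Lc] {c θ : ℝ} (hc : 0 ≤ c) (hθ0 : 0 ≤ θ) (hθ1 : θ < 1)
    (hR : ∀ (n : ℕ) (κ l : Fin 4) (z : Fin 4 → ℤ), ∀ p ∈ BZ 4, p ≠ 0 →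
      ‖diffSym (Lc ^ (n + 1)) (Lc ^ (n + 2)) Lc κ l z (ofRealVec p)‖ ≤ c * θ ^ n) :
    ∃ c' θ' κ' : ℝ, 0 ≤ c' ∧ 0 ≤ θ' ∧ θ' < 1 ∧ 0 < κ' ∧ ∀ (n : ℕ) (κ l : Fin 4) (z : Fin 4 → ℤ),
      |((Lc : ℝ) ^ (3 + 1))⁻¹ * ∑ r ∈ box (3 + 1) Lc,
            ((Lc : ℝ) ^ (n + 2)) ^ (3 + 2) * wH (N := Lc ^ (n + 2)) κ l ((Lc : ℤ) • z + toSite r) -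
          ((Lc : ℝ) ^ (n + 1)) ^ (3 + 2) * wH (N := Lc ^ (n + 1)) κ l z| ≤
        c' * θ' ^ n * Real.exp (-κ' * l1 (quo (Lc ^ (n + 1)) z)) := by
  obtain ⟨κ₀, C, hκ₀, _, hN1⟩ := exists_wH_decay (Lc := Lc)
  exact exists_wH_cellMean_cauchy_of_puncturedRate (d := 3) Lc hκ₀ hc hθ0 hθ1 hN1 hR

end Summit.QuantumFields.BalabanUV.Beta.GAN24.FineReadoutCauchyReal

end
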